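import Mathlib
import Literature.Combinatorics.Additive.TripleProductProperty
import Literature.Computability.AutomaticStructures.AutomaticBlock

/-!
# Carry-robust charts give cyclic STPP designs (CKSU 2005, Thm. 6.6, read in `ℤ/p^k`)

Route `MatrixMultiplication/AutomaticSTPPDesigns`, crux `AutomaticPackingThesis`
(stmt-MatrixMultiplication-7356), line `Sketch`, stub `stub_chartSTPP` (support file).

Cohn–Kleinberg–Szegedy–Umans 2005, §6.3 (Def. 6.5 / Thm. 6.6; Definition 36 / Theorem 37 in the
sequential numbering of the arXiv text): an `H`-*chart* assigns to every symbol `x ∈ Γ` three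
subsets `A(x), B(x), C(x) ⊆ H` with the triple product property, and a code `U ⊆ Γ^k` in which every
ordered triple `(u, v, w)`, not all equal, has a *witness coordinate* `j` with
`0 ∉ A(u_j) - A(w_j) + B(v_j) - B(u_j) + C(w_j) - C(v_j)` makes the product sets
`A_u = ∏_j A(u_j)`, `B_u`, `C_u ⊆ H^k` an STPP family (CKSU Def. 5.1, the tree's
`AddSimultaneousTPP`).

Here the host `H^k = (ℤ/p)^k` is replaced by the CYCLIC group `ℤ/p^k`: the digit box
`∏_j A(u_j) ⊆ (Fin p)^k` is read as base-`p` numbers, least significant digit first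
(`Literature.Computability.AutomaticStructures.digitValue`). The STPP equation
`(s' - s) + (t' - t) + (c' - c) = 0` in `ℤ/p^k` is then the LSB-first carry recursion
`cr 0 = 0`, `cr_j + d_j = p · cr_{j+1}` of `stppSum_eq_zero_iff`, with digit combinations
`d_j = stppDigit … j ∈ [-3(p-1), 3(p-1)]`.

* `abs_carry_le_two` — the carries of a solution are bounded by `2` (not only by `3`):
  `p |cr_{j+1}| ≤ |cr_j| + 3(p-1) ≤ 3p - 1 < 3p`.
* `stub_chartSTPP` — the chart theorem with carries: if the symbol triples have the TPP in `ℤ/p`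
  and every non-constant triple of `U` has a coordinate where the digit combination stays off
  `[-2, 2]` modulo `p` (a carry-robust witness), the digit boxes form an STPP family in `ℤ/p^k`.
  For a non-constant index triple the witness coordinate `j` contradicts the recursion
  (`d_j + cr_j = p cr_{j+1} ≡ 0 (mod p)` with `|cr_j| ≤ 2`); for a constant triple `u = v = w` the
  symbol TPPs kill the carries inductively from digit `0` (`d_j ≡ 0 (mod p)` is the TPP relation
  of `(A(u_j), B(u_j), C(u_j))` in `ℤ/p`, so the digits agree, `d_j = 0`, and `cr_{j+1} = 0`).

## References

* H. Cohn, R. Kleinberg, B. Szegedy, C. Umans, *Group-theoretic algorithms for matrix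
  multiplication*, FOCS 2005, arXiv:math/0511460, Def. 5.1 and §6.3 (charts, Thm. 6.6).
-/

-- single-conjunct summit: the mandated namespace repeats `MatrixMultiplication`.
set_option linter.dupNamespace false

namespace Summit.MatrixMultiplication.MatrixMultiplication.Theorems.AutomaticPackingThesis

open Finset Literature.Combinatorics.Additive Literature.Computability.AutomaticStructures

/-- **Carries of an STPP solution are bounded by `2`.** If `cr 0 = 0`, `cr_j + d_j = p cr_{j+1}`
and `|d_j| ≤ 3 (p - 1)` for all `j < k` (`p ≠ 0`), then `|cr_i| ≤ 2` for every `i ≤ k`: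
inductively `p |cr_{j+1}| ≤ |cr_j| + |d_j| ≤ 2 + 3(p - 1) = 3p - 1 < 3p`. [folklore] -/
theorem abs_carry_le_two {p k : ℕ} (hp : 0 < p) {cr : Fin (k + 1) → ℤ} {d : Fin k → ℤ}
    (h0 : cr 0 = 0) (hrel : ∀ j : Fin k, cr j.castSucc + d j = p * cr j.succ)
    (hd : ∀ j : Fin k, |d j| ≤ 3 * ((p : ℤ) - 1)) (i : Fin (k + 1)) : |cr i| ≤ 2 := by
  induction i using Fin.induction with
  | zero => simp [h0]
  | succ i ih =>
    have hp' : (0 : ℤ) < p := by exact_mod_cast hp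
    have h1 : (p : ℤ) * |cr i.succ| < p * 3 := by
      calc (p : ℤ) * |cr i.succ| = |cr i.castSucc + d i| := by
            rw [hrel i, abs_mul, abs_of_pos hp']
        _ ≤ |cr i.castSucc| + |d i| := abs_add_le _ _
        _ ≤ 2 + 3 * ((p : ℤ) - 1) := add_le_add ih (hd i)
        _ < p * 3 := by linarith
    have h2 : |cr i.succ| < 3 := lt_of_mul_lt_mul_left h1 hp'.le
    rw [abs_lt] at h2
    rw [abs_le]
    omega

/-- Reading digits in `ℤ/p` is injective: `(a : ZMod p) = (b : ZMod p)` for digits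
`a b : Fin p` forces `a = b`. [folklore] -/
theorem fin_eq_of_natCast_eq {p : ℕ} {a b : Fin p}
    (h : ((a : ℕ) : ZMod p) = ((b : ℕ) : ZMod p)) : a = b := by
  apply Fin.ext
  have h' := congrArg ZMod.val h
  rwa [ZMod.val_cast_of_lt a.is_lt, ZMod.val_cast_of_lt b.is_lt] at h'

/-- **Carry-robust chart theorem, one scale** (Cohn–Kleinberg–Szegedy–Umans 2005, §6.3,
Thm. 6.6 = Theorem 37 of the arXiv text, read with carries in the cyclic group `ℤ/p^k`).
Let `A B C : Γ → Finset (Fin p)` (`p ≥ 2`) be digit sets whose symbol triples, read in `ℤ/p`,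
have the triple product property, and let `U ⊆ Γ^k` be a code in which every ordered triple
`(u, v, w)`, not all equal, has a coordinate `j` such that for all `s ∈ A (w j)`, `s' ∈ A (u j)`,
`t ∈ B (u j)`, `t' ∈ B (v j)`, `c ∈ C (v j)`, `c' ∈ C (w j)` and every carry `|e| ≤ 2` the digit
combination `(s' - s) + (t' - t) + (c' - c) + e` is non-zero modulo `p`. Then the digit boxes
`∏_j A (u j)`, `∏_j B (u j)`, `∏_j C (u j)` (`u ∈ U`), read in base `p` (least significant digit
first) in `ℤ/p^k`, satisfy the simultaneous triple product property. Proof: in the one-clause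
form (`addSimultaneousTPP_iff_forall`) an STPP relation is a carry recursion
(`stppSum_eq_zero_iff`) with carries bounded by `2` (`abs_carry_le_two`); a non-constant index
triple is refuted at its witness coordinate, and for a constant triple the symbol TPPs force equal
digits and zero carries position by position.
[cite: CohnKleinbergSzegedyUmans2005, Thm. 6.6 (Theorem 37)] -/
theorem stub_chartSTPP (p k : ℕ) (hp : 2 ≤ p) (Γ : Type) [DecidableEq Γ]
    (A B C : Γ → Finset (Fin p))
    (hT : ∀ x : Γ, AddTripleProductProperty
      ((A x).image fun d : Fin p => ((d : ℕ) : ZMod p))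
      ((B x).image fun d : Fin p => ((d : ℕ) : ZMod p))
      ((C x).image fun d : Fin p => ((d : ℕ) : ZMod p)))
    (U : Finset (Fin k → Γ))
    (hU : ∀ u ∈ U, ∀ v ∈ U, ∀ w ∈ U, ¬ (u = v ∧ v = w) → ∃ j : Fin k,
      ∀ s ∈ A (w j), ∀ s' ∈ A (u j), ∀ t ∈ B (u j), ∀ t' ∈ B (v j), ∀ c ∈ C (v j),
        ∀ c' ∈ C (w j), ∀ e : ℤ, |e| ≤ 2 →
          (((((s' : ℕ) : ℤ) - (s : ℕ)) + (((t' : ℕ) : ℤ) - (t : ℕ)) + (((c' : ℕ) : ℤ) - (c : ℕ))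
            + e : ℤ) : ZMod p) ≠ 0) :
    AddSimultaneousTPP
      (fun u : U => (Fintype.piFinset fun j => A (u.1 j)).image
        fun a : Fin k → Fin p => (digitValue a : ZMod (p ^ k)))
      (fun u : U => (Fintype.piFinset fun j => B (u.1 j)).image
        fun a : Fin k → Fin p => (digitValue a : ZMod (p ^ k)))
      (fun u : U => (Fintype.piFinset fun j => C (u.1 j)).image
        fun a : Fin k → Fin p => (digitValue a : ZMod (p ^ k))) := by
  have hp0 : 0 < p := by omega
  have hpz : (p : ℤ) ≠ 0 := by exact_mod_cast hp0.ne'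
  rw [addSimultaneousTPP_iff_forall]
  rintro ⟨u, hu⟩ ⟨v, hv⟩ ⟨w, hw⟩ s hs s' hs' t ht t' ht' c hc c' hc' h0
  simp only [mem_image, Fintype.mem_piFinset] at hs hs' ht ht' hc hc'
  obtain ⟨S, hS, rfl⟩ := hs
  obtain ⟨S', hS', rfl⟩ := hs'
  obtain ⟨T, hTm, rfl⟩ := ht
  obtain ⟨T', hT'm, rfl⟩ := ht'
  obtain ⟨V, hV, rfl⟩ := hc
  obtain ⟨V', hV', rfl⟩ := hc'
  -- the STPP relation as an LSB-first carry recursion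
  obtain ⟨cr, hcr0, hrel⟩ := (stppSum_eq_zero_iff hp0 S S' T T' V V').1 h0
  by_cases huvw : u = v ∧ v = w
  · -- constant index triple: the symbol TPPs kill the carries digit by digit
    obtain ⟨rfl, rfl⟩ := huvw
    have step : ∀ j : Fin k, cr j.castSucc = 0 →
        S j = S' j ∧ T j = T' j ∧ V j = V' j ∧ cr j.succ = 0 := by
      intro j hj
      have h := hrel j
      rw [hj, zero_add] at h
      -- digit `j`: `p ∣ d_j`, i.e. the TPP relation of the symbol triple in `ℤ/p`
      have h' := congrArg (Int.cast : ℤ → ZMod p) h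
      simp only [stppDigit, Int.cast_add, Int.cast_sub, Int.cast_mul, Int.cast_natCast,
        ZMod.natCast_self, zero_mul] at h'
      have hz : ((S' j : ℕ) : ZMod p) + -((S j : ℕ) : ZMod p)
          + (((T' j : ℕ) : ZMod p) + -((T j : ℕ) : ZMod p))
          + (((V' j : ℕ) : ZMod p) + -((V j : ℕ) : ZMod p)) = 0 := by
        linear_combination h'
      obtain ⟨h1, h2, h3⟩ := hT _ _ (mem_image_of_mem _ (hS' j)) _ (mem_image_of_mem _ (hS j))
        _ (mem_image_of_mem _ (hT'm j)) _ (mem_image_of_mem _ (hTm j))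
        _ (mem_image_of_mem _ (hV' j)) _ (mem_image_of_mem _ (hV j)) hz
      have e1 : S' j = S j := fin_eq_of_natCast_eq h1
      have e2 : T' j = T j := fin_eq_of_natCast_eq h2
      have e3 : V' j = V j := fin_eq_of_natCast_eq h3
      refine ⟨e1.symm, e2.symm, e3.symm, ?_⟩
      -- equal digits: no carry out of position `j`
      have hd0 : stppDigit S S' T T' V V' j = 0 := by
        simp only [stppDigit, e1, e2, e3, sub_self, add_zero]
      rw [hd0] at h
      exact (mul_eq_zero.1 h.symm).resolve_left hpz
    have hzero : ∀ i : Fin (k + 1), cr i = 0 := by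
      intro i
      induction i using Fin.induction with
      | zero => exact hcr0
      | succ j ih => exact (step j ih).2.2.2
    have eS : S = S' := funext fun j => (step j (hzero _)).1
    have eT : T = T' := funext fun j => (step j (hzero _)).2.1
    have eV : V = V' := funext fun j => (step j (hzero _)).2.2.1
    exact ⟨rfl, rfl, by rw [eS], by rw [eT], by rw [eV]⟩
  · -- non-constant index triple: the witness coordinate refutes the recursion
    exfalso
    obtain ⟨j, hj⟩ := hU u hu v hv w hw huvw
    have hbd : |cr j.castSucc| ≤ 2 :=
      abs_carry_le_two hp0 hcr0 hrel (fun i => abs_stppDigit_le S S' T T' V V' i) j.castSucc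
    refine hj (S j) (hS j) (S' j) (hS' j) (T j) (hTm j) (T' j) (hT'm j) (V j) (hV j) (V' j)
      (hV' j) (cr j.castSucc) hbd ?_
    have h := hrel j
    have h' : (((S' j : ℕ) : ℤ) - (S j : ℕ)) + (((T' j : ℕ) : ℤ) - (T j : ℕ))
        + (((V' j : ℕ) : ℤ) - (V j : ℕ)) + cr j.castSucc = p * cr j.succ := by
      rw [← h, stppDigit]
      ring
    rw [h', Int.cast_mul, Int.cast_natCast, ZMod.natCast_self, zero_mul]

end Summit.MatrixMultiplication.MatrixMultiplication.Theorems.AutomaticPackingThesis
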